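import Mathlib
import HarnessLib
import Literature.NumberTheory.LFunctions.ZetaScrew
import Summits.RiemannHypothesis.RiemannHypothesis.Theorems.IntegerScrewGramCeiling
import Summits.RiemannHypothesis.RiemannHypothesis.Theorems.IntegerScrewArithmeticBrackets

/-!
# Route `IntegerScrew` — LOCAL POSITIVITY of the arithmetic Gram block: the increments `I_M, I_{M−k} (k ≤ K),
# I_{⌈M/q⌉} (q ∈ P)` have a positive-definite Gram matrix for `M ≥ M₀(K, P)`, unconditionally
# (PIVOT-LAW §15.9 (ii) extended to the hinge carriers; RH-FREE, no positivity hypothesis)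

RH ⇔ every finite Gram matrix of increments of Kreĭn's screw line for `Ψ` is positive semidefinite (Suzuki's
criterion on zero-sum configurations).  `IntegerScrewKNodeSharp.eventually_incrementGram_ge_half_log` showed that
the `K + 1` increments at the corner can never witness a failure for large `M`.  Here the same for the ARITHMETIC
family of the joint floor (neighbours + prime-power hinge carriers): its scaled Gram matrix is diagonally dominant —
diagonals `≍ w_i·log M` (`w = 1` resp. `q`), all cross terms `O(1)` (`IntegerScrewArithmeticBrackets`):

* `eventually_gram_ge_half` — abstract: in the «rows + diagonals + bounded cross terms» setting (all indices,
  including the corner, with `g_M(i,i)/L_M → w_i > 0` and bounded off-diagonal entries), eventually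
  `Σ_{i,j} u_i u_j g_M(i,j) ≥ (L_M/2)·Σ_i w_i u_i²` for all `u`;
* **`eventually_arithmeticGram_pos`** — for every `K`, `P` (integers `≥ 2`): eventually in `M`, the Gram form
  `Σ_{i,j ∈ range(K+1) ⊕ P} θ_iθ_j ⟨I_{a_i}, I_{a_j}⟩` is `≥ (log M/(2M))·Σ θ_i²`, in particular positive definite.

So an indefinite screw Gram matrix (a failure of RH) is never supported on boundedly many increments at the corner and
at fixed prime-power ratios below it.  Elementary; nothing here bears on the truth of RH. [Suzuki2023, (1.4)]
-/

noncomputable section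

-- D-0017: `Summit.<S>.<S>.…` is the designed namespace of a single-problem summit.
set_option linter.dupNamespace false

namespace Summit.RiemannHypothesis.RiemannHypothesis.Theorems.IntegerScrew

open Literature.NumberTheory.LFunctions Filter Finset
open scoped Topology

/-- **ABSTRACT DIAGONAL DOMINANCE.**  Finite index set `s`, `g_M` symmetric on `s`, `L_M → ∞`,
`g_M(i,i)/L_M → w_i > 0` for every `i ∈ s`, and `g_M(i,j)` eventually bounded for `i ≠ j`: then eventually in
`M`, for all `u`, `Σ_{i,j ∈ s} u_i u_j g_M(i,j) ≥ (L_M/2)·Σ_{i ∈ s} w_i u_i²`. [folklore] -/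
theorem eventually_gram_ge_half {ι : Type*} [DecidableEq ι] (s : Finset ι)
    (g : ℕ → ι → ι → ℝ) (L : ℕ → ℝ) (w : ι → ℝ)
    (hL : Tendsto L atTop atTop)
    (hsymm : ∀ M, ∀ i ∈ s, ∀ j ∈ s, g M i j = g M j i)
    (hdiag : ∀ i ∈ s, Tendsto (fun M => g M i i / L M) atTop (𝓝 (w i)))
    (hw : ∀ i ∈ s, 0 < w i)
    (hoff : ∀ i ∈ s, ∀ j ∈ s, i ≠ j → ∃ B : ℝ, ∀ᶠ M in atTop, |g M i j| ≤ B) :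
    ∀ᶠ M in atTop, ∀ u : ι → ℝ,
      L M / 2 * ∑ i ∈ s, w i * u i ^ 2 ≤ ∑ i ∈ s, ∑ j ∈ s, u i * u j * g M i j := by
  -- the Gershgorin radius R_i(M) := Σ_{j ∈ s, j ≠ i} |g_M(i,j)| has R_i/L → 0
  set R : ℕ → ι → ℝ := fun M i => ∑ j ∈ s, (if j = i then 0 else |g M i j|) with hR
  have hLinv : Tendsto (fun M => (L M)⁻¹) atTop (𝓝 0) := hL.inv_tendsto_atTop
  have hRlim : ∀ i ∈ s, Tendsto (fun M => R M i / L M) atTop (𝓝 0) := by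
    intro i hi
    simp only [hR, Finset.sum_div]
    rw [show (0 : ℝ) = ∑ j ∈ s, (0 : ℝ) by simp]
    refine tendsto_finsetSum s fun j hj => ?_
    by_cases hji : j = i
    · simp [hji]
    · simp only [hji, if_false]
      obtain ⟨B, hB⟩ := hoff i hi j hj (Ne.symm hji)
      have hbound : ∀ᶠ M in atTop, ‖|g M i j| / L M‖ ≤ B * |(L M)⁻¹| := by
        filter_upwards [hB] with M hM
        rw [Real.norm_eq_abs, div_eq_mul_inv, abs_mul, abs_abs]
        gcongr
      refine squeeze_zero_norm' hbound ?_
      have : Tendsto (fun M => B * |(L M)⁻¹|) atTop (𝓝 (B * |0|)) :=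
        ((continuous_abs.tendsto 0).comp hLinv).const_mul B
      simpa using this
  -- d_i/L := (g_ii − R_i)/L → w_i > w_i/2
  have hdlim : ∀ i ∈ s, Tendsto (fun M => (g M i i - R M i) / L M) atTop (𝓝 (w i)) := by
    intro i hi
    have := (hdiag i hi).sub (hRlim i hi)
    rw [sub_zero] at this
    exact this.congr fun M => by ring
  have hev : ∀ᶠ M in atTop, ∀ i ∈ s, w i / 2 < (g M i i - R M i) / L M :=
    (eventually_all_finset s).2 fun i hi =>
      (hdlim i hi).eventually (Ioi_mem_nhds (by linarith [hw i hi]))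
  have hLpos : ∀ᶠ M in atTop, 0 < L M := hL.eventually (eventually_gt_atTop 0)
  filter_upwards [hev, hLpos] with M hM hLM u
  have hG := finsetSum_mul_ge_diag_sub_offdiag s u (g M) (fun i hi j hj => hsymm M i hi j hj)
  refine le_trans ?_ hG
  rw [Finset.mul_sum]
  refine Finset.sum_le_sum fun i hi => ?_
  have h1 : w i / 2 * L M ≤ g M i i - R M i := by
    have := (hM i hi).le
    rwa [le_div_iff₀ hLM] at this
  have hu : 0 ≤ u i ^ 2 := sq_nonneg _
  calc L M / 2 * (w i * u i ^ 2) = (w i / 2 * L M) * u i ^ 2 := by ring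
    _ ≤ (g M i i - R M i) * u i ^ 2 := mul_le_mul_of_nonneg_right h1 hu
    _ = (g M i i - ∑ j ∈ s, (if j = i then 0 else |g M i j|)) * u i ^ 2 := by simp only [hR]

/-- **LOCAL POSITIVITY OF THE ARITHMETIC GRAM BLOCK** (RH-FREE, unconditional).  For every `K : ℕ` and every
finite set `P` of integers `≥ 2`, eventually in `M`, for every `θ : ℕ ⊕ ℕ → ℝ` (labels `a(inl k) = M − k`,
`a(inr q) = ⌈M/q⌉ = (M + q − 1)/q`):
`(log M/(2M))·Σ_{i ∈ range(K+1) ⊕ P} θ_i² ≤ Σ_{i,j} θ_iθ_j·B(a_i, a_j)`, `B(a,b) = ⟨I_a, I_b⟩` — the Gram matrix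
of the increments `I_M, …, I_{M−K}` and `I_{⌈M/q⌉}` (`q ∈ P`) dominates `(log M/(2M))·I`; in particular it is
positive definite for `M ≥ M₀(K,P)`. [folklore] -/
theorem eventually_arithmeticGram_pos (K : ℕ) (P : Finset ℕ) (hP : ∀ n ∈ P, 2 ≤ n) :
    ∀ᶠ M : ℕ in atTop, ∀ θ : ℕ ⊕ ℕ → ℝ,
      Real.log (M : ℝ) / (2 * (M : ℝ)) * ∑ i ∈ (Finset.range (K + 1)).disjSum P, θ i ^ 2 ≤
        ∑ i ∈ (Finset.range (K + 1)).disjSum P, ∑ j ∈ (Finset.range (K + 1)).disjSum P,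
          θ i * θ j *
            (zetaScrew (Real.log ((Sum.elim (fun k : ℕ => M - k) (fun n : ℕ => (M + n - 1) / n) i : ℕ) : ℝ)
                - Real.log (((Sum.elim (fun k : ℕ => M - k) (fun n : ℕ => (M + n - 1) / n) j : ℕ) : ℝ) - 1))
              + zetaScrew (Real.log (((Sum.elim (fun k : ℕ => M - k) (fun n : ℕ => (M + n - 1) / n) i : ℕ) : ℝ) - 1)
                - Real.log ((Sum.elim (fun k : ℕ => M - k) (fun n : ℕ => (M + n - 1) / n) j : ℕ) : ℝ))
              - zetaScrew (Real.log ((Sum.elim (fun k : ℕ => M - k) (fun n : ℕ => (M + n - 1) / n) i : ℕ) : ℝ)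
                - Real.log ((Sum.elim (fun k : ℕ => M - k) (fun n : ℕ => (M + n - 1) / n) j : ℕ) : ℝ))
              - zetaScrew (Real.log (((Sum.elim (fun k : ℕ => M - k) (fun n : ℕ => (M + n - 1) / n) i : ℕ) : ℝ) - 1)
                - Real.log (((Sum.elim (fun k : ℕ => M - k) (fun n : ℕ => (M + n - 1) / n) j : ℕ) : ℝ) - 1))) := by
  classical
  set s : Finset (ℕ ⊕ ℕ) := (Finset.range (K + 1)).disjSum P with hs
  set lab : ℕ → ℕ ⊕ ℕ → ℕ := fun M => Sum.elim (fun k => M - k) (fun n => (M + n - 1) / n) with hlab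
  set w : ℕ ⊕ ℕ → ℝ := Sum.elim (fun _ : ℕ => (1 : ℝ)) (fun n : ℕ => (n : ℝ)) with hw
  set L : ℕ → ℝ := fun M => Real.log (M : ℝ) with hL
  set g : ℕ → (ℕ ⊕ ℕ) → (ℕ ⊕ ℕ) → ℝ := fun M i j => (M : ℝ) *
    (zetaScrew (Real.log (lab M i : ℝ) - Real.log ((lab M j : ℝ) - 1))
      + zetaScrew (Real.log ((lab M i : ℝ) - 1) - Real.log (lab M j : ℝ))
      - zetaScrew (Real.log (lab M i : ℝ) - Real.log (lab M j : ℝ))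
      - zetaScrew (Real.log ((lab M i : ℝ) - 1) - Real.log ((lab M j : ℝ) - 1))) with hg
  have hmem : ∀ i ∈ s, (∃ k, i = Sum.inl k ∧ k < K + 1) ∨ (∃ n, i = Sum.inr n ∧ n ∈ P) := by
    intro i hi
    rcases i with k | n
    · exact Or.inl ⟨k, rfl, Finset.mem_range.1 (Finset.inl_mem_disjSum.1 hi)⟩
    · exact Or.inr ⟨n, rfl, Finset.inr_mem_disjSum.1 hi⟩
  have hLT : Tendsto L atTop atTop := Real.tendsto_log_atTop.comp tendsto_natCast_atTop_atTop
  have hsymm : ∀ M, ∀ i ∈ s, ∀ j ∈ s, g M i j = g M j i := by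
    intro M i _ j _
    simp only [hg]
    rw [bracket_symm]
  have hdiag : ∀ i ∈ s, Tendsto (fun M => g M i i / L M) atTop (𝓝 (w i)) := by
    intro i hi
    rcases hmem i hi with ⟨k, rfl, hk⟩ | ⟨n, rfl, hn⟩
    · simp only [hg, hlab, hw, hL, Sum.elim_inl]
      exact tendsto_lagBracket_self_div_log k
    · simp only [hg, hlab, hw, hL, Sum.elim_inr]
      exact tendsto_ceilBracket_self_div_log (hP n hn)
  have hwpos : ∀ i ∈ s, 0 < w i := by
    intro i hi
    rcases hmem i hi with ⟨k, rfl, hk⟩ | ⟨n, rfl, hn⟩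
    · simp only [hw, Sum.elim_inl]; exact one_pos
    · simp only [hw, Sum.elim_inr]
      exact_mod_cast (by have := hP n hn; omega : 0 < n)
  have hoff : ∀ i ∈ s, ∀ j ∈ s, i ≠ j → ∃ B : ℝ, ∀ᶠ M in atTop, |g M i j| ≤ B := by
    intro i hi j hj hij
    rcases hmem i hi with ⟨k, rfl, hk⟩ | ⟨n, rfl, hn⟩
    · rcases hmem j hj with ⟨k', rfl, hk'⟩ | ⟨n', rfl, hn'⟩
      · have hkk : k ≠ k' := fun h => hij (by rw [h])
        simp only [hg, hlab, Sum.elim_inl]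
        exact eventually_abs_lagBracket_le hkk
      · simp only [hg, hlab, Sum.elim_inl, Sum.elim_inr]
        exact eventually_abs_lagCeilBracket_le k (hP n' hn')
    · rcases hmem j hj with ⟨k', rfl, hk'⟩ | ⟨n', rfl, hn'⟩
      · obtain ⟨B, hB⟩ := eventually_abs_lagCeilBracket_le k' (hP n hn)
        refine ⟨B, ?_⟩
        filter_upwards [hB] with M hM
        simp only [hg, hlab, Sum.elim_inl, Sum.elim_inr]
        rw [bracket_symm]
        exact hM
      · have hnn : n ≠ n' := fun h => hij (by rw [h])
        simp only [hg, hlab, Sum.elim_inr]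
        exact eventually_abs_ceilCeilBracket_le (hP n hn) (hP n' hn') hnn
  have hmain := eventually_gram_ge_half s g L w hLT hsymm hdiag hwpos hoff
  filter_upwards [hmain, eventually_ge_atTop 1] with M hM hM1 θ
  have hM0 : (0 : ℝ) < M := by exact_mod_cast (by omega : 0 < M)
  have h := hM θ
  -- Σ w_i θ_i² ≥ Σ θ_i² (w ≥ 1 on s), and g = M·B
  have hw1 : ∑ i ∈ s, θ i ^ 2 ≤ ∑ i ∈ s, w i * θ i ^ 2 := by
    refine Finset.sum_le_sum fun i hi => ?_
    have : 1 ≤ w i := by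
      rcases hmem i hi with ⟨k, rfl, hk⟩ | ⟨n, rfl, hn⟩
      · simp [hw]
      · simp only [hw, Sum.elim_inr]; exact_mod_cast (by have := hP n hn; omega : 1 ≤ n)
    nlinarith [sq_nonneg (θ i)]
  have hLnn : 0 ≤ L M / 2 := by
    simp only [hL]; exact div_nonneg (Real.log_nonneg (by exact_mod_cast hM1)) (by norm_num)
  have hQ : ∑ i ∈ s, ∑ j ∈ s, θ i * θ j * g M i j
      = (M : ℝ) * ∑ i ∈ s, ∑ j ∈ s, θ i * θ j *
        (zetaScrew (Real.log (lab M i : ℝ) - Real.log ((lab M j : ℝ) - 1))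
          + zetaScrew (Real.log ((lab M i : ℝ) - 1) - Real.log (lab M j : ℝ))
          - zetaScrew (Real.log (lab M i : ℝ) - Real.log (lab M j : ℝ))
          - zetaScrew (Real.log ((lab M i : ℝ) - 1) - Real.log ((lab M j : ℝ) - 1))) := by
    rw [Finset.mul_sum]
    refine Finset.sum_congr rfl fun i _ => ?_
    rw [Finset.mul_sum]
    refine Finset.sum_congr rfl fun j _ => ?_
    simp only [hg]
    ring
  have h2 : L M / 2 * ∑ i ∈ s, θ i ^ 2 ≤ (M : ℝ) * ∑ i ∈ s, ∑ j ∈ s, θ i * θ j *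
        (zetaScrew (Real.log (lab M i : ℝ) - Real.log ((lab M j : ℝ) - 1))
          + zetaScrew (Real.log ((lab M i : ℝ) - 1) - Real.log (lab M j : ℝ))
          - zetaScrew (Real.log (lab M i : ℝ) - Real.log (lab M j : ℝ))
          - zetaScrew (Real.log ((lab M i : ℝ) - 1) - Real.log ((lab M j : ℝ) - 1))) := by
    rw [← hQ]
    exact (mul_le_mul_of_nonneg_left hw1 hLnn).trans h
  -- divide by M
  have h3 := mul_le_mul_of_nonneg_left h2 (show (0 : ℝ) ≤ 1 / (M : ℝ) by positivity)
  rw [← mul_assoc (1 / (M : ℝ)) (M : ℝ), one_div_mul_cancel hM0.ne', one_mul] at h3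
  have key : 1 / (M : ℝ) * (L M / 2 * ∑ i ∈ s, θ i ^ 2)
      = Real.log (M : ℝ) / (2 * (M : ℝ)) * ∑ i ∈ s, θ i ^ 2 := by
    simp only [hL]; ring
  rw [key] at h3
  exact h3

end Summit.RiemannHypothesis.RiemannHypothesis.Theorems.IntegerScrew

end
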